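import Summits.BirchSwinnertonDyer.Rank1Residual.Supersingular.RankOneRem13RecordShapesMinimality
import Summits.BirchSwinnertonDyer.BirchSwinnertonDyer.Theorems.Rank1ResidualIntModelSurjectivity
import HarnessLib

/-!
# `surj(p)` for a LITERAL integer equation from three Serre witnesses (Serre 1972 Prop. 19) — the
# record shape that retires the `hsurj` DATA binder of the rank-one rem13 records at `p ≥ 5`
# (cell `b2b-bsdres`, supersingular family prover B = unit `b2b-bsdres-additive-p3`, gen 20; TOOL)

HONEST FRAMING (run/shared/lean/b2b/bsd-rank1-residual/, verbatim in every file): the goal of the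
cell is to DELETE the COMBINATION-SHAPED residual classes of the Birch–Swinnerton-Dyer formula for
ALL analytic-rank `≤ 1` elliptic curves over `ℚ` — "full BSD formula for every rank `≤ 1` curve in
class `C`" assembled STRICTLY from published theorems — so that the rank-`≤ 1` remainder becomes
exactly the CONSTRUCTION-SHAPED classes, which are TYPED (missing-input `Prop`s), NOT attempted.
This is not "finishing BSD". THEOREMS ONLY (no definition, no named fact); nothing booked.

x11c's `IntModel.hasSurjectiveModNGaloisRep_of_intModel_of_serreWitnesses` proves `ρ̄_{E,p}` onto
(`p ≥ 5`) for a globally minimal `W` with integral model `E₀` from three good primes `ℓ₁, ℓ₂, ℓ₃ ≠ p`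
whose Frobenius traces (kernel point counts) satisfy Serre's conditions (i) `a₁² − 4ℓ₁` a non-zero
square, `a₁ ≠ 0`; (ii) `a₂² − 4ℓ₂` a non-square, `a₂ ≠ 0`; (iii) `a₃² = uℓ₃`, `u ∉ {0,1,2,4}`,
`u² − 3u + 1 ≠ 0` (mod `p`). This file packages it for a LITERAL equation `[a₁,…,a₆]` with every
hypothesis in `decide`-able form: global minimality as an explicit hypothesis (x11c's / this gen's
bounded or factored criteria), the three counts as schema counts `countPoints [a] ℓᵢ = nᵢ`, the
square in (i) by an explicit root `r`, the NON-square in (ii) by EULER'S CRITERION `d₂^{(p−1)/2} = −1`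
(`ZMod.euler_criterion`), and (iii) by an explicit `u`. Consumer: the `hsurj` binder of
`RankOneRem13RecordsX7Unit*.lean` at `p ≥ 5` (994 of the 1 142 O4 unit rows).

References: J.-P. Serre, Invent. Math. 15 (1972) §2.8 Prop. 19, §5.2 (iii) [Serre1972]; B. Mazur,
Invent. Math. 44 (1978) Prop. 6.3 (1) [Mazur1978]; K. Ireland, M. Rosen, GTM 84 (1990) Prop. 5.1.2
[IrelandRosen1990]; J. H. Silverman, *AEC* (2009) VII.1, VIII.8 [SilvermanAEC2009].
-/

set_option autoImplicit false

noncomputable section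

open scoped Classical

open WeierstrassCurve Literature.NumberTheory.EllipticCurves
  Literature.NumberTheory.EllipticCurves.Rank1Residual
  Literature.NumberTheory.EllipticCurves.Rank1Residual.X11RankOneCertificates
  Summit.BirchSwinnertonDyer.BirchSwinnertonDyer.Rank1Residual.IntModel
  Summit.BirchSwinnertonDyer.BirchSwinnertonDyer.Rank1Residual.X11RankOne
  Summit.BirchSwinnertonDyer.Rank1Residual.X11b

namespace Summit.BirchSwinnertonDyer.Rank1Residual.Supersingular

/-- **Euler's criterion, non-square half**: in `ZMod p` (`p` an odd prime), `d ^ (p / 2) = −1`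
forces `d` to be a non-zero NON-square. [cite: IrelandRosen1990, Prop. 5.1.2 (Euler's criterion)] -/
theorem not_isSquare_of_pow_div_two_eq_neg_one (p : ℕ) [Fact p.Prime] (hp2 : p ≠ 2) {d : ZMod p}
    (hd : d ^ (p / 2) = -1) : ¬ IsSquare d ∧ d ≠ 0 := by
  haveI : Fact (2 < p) := ⟨by
    have h2 := (Fact.out : p.Prime).two_le
    omega⟩
  have hd0 : d ≠ 0 := by
    rintro rfl
    have hp : p / 2 ≠ 0 := by
      have h2 := (Fact.out : p.Prime).two_le
      omega
    rw [zero_pow hp] at hd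
    exact (neg_ne_zero.mpr one_ne_zero) hd.symm
  refine ⟨fun hsq ↦ ?_, hd0⟩
  have h1 := (ZMod.euler_criterion p hd0).mp hsq
  rw [hd] at h1
  exact ZMod.neg_one_ne_one h1

/-- **CERTIFICATE SHAPE: `surj(p)` (`p ≥ 5`) for the literal equation `[a₁,…,a₆]` from three Serre
witnesses**, all hypotheses kernel-decidable: `hmin` global minimality (explicit), odd good primes
`ℓᵢ ∤ Δ`, `ℓᵢ ≠ p`, schema counts `countPoints [a] ℓᵢ = nᵢ` (`aᵢ = ℓᵢ + 1 − nᵢ`), and Serre's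
(i) with an explicit square root `r` of `a₁² − 4ℓ₁`, (ii) by Euler's criterion
`(a₂² − 4ℓ₂)^{(p−1)/2} = −1`, (iii) with an explicit `u = a₃²/ℓ₃`.
[cite: Serre1972, §2.8 Prop. 19 and §5.2 (iii)] [cite: IrelandRosen1990, Prop. 5.1.2] -/
theorem surj_of_ainvs_of_serreWitnesses (a1 a2 a3 a4 a6 : ℤ) (p : ℕ) [Fact p.Prime] (h5 : 5 ≤ p)
    (hmin : (⟨a1, a2, a3, a4, a6⟩ : WeierstrassCurve ℚ).IsGloballyMinimal)
    (ℓ₁ ℓ₂ ℓ₃ : ℕ) (hℓ₁ : ℓ₁.Prime) (hℓ₂ : ℓ₂.Prime) (hℓ₃ : ℓ₃.Prime)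
    (h2₁ : ℓ₁ ≠ 2) (h2₂ : ℓ₂ ≠ 2) (h2₃ : ℓ₃ ≠ 2) (h₁ : ℓ₁ ≠ p) (h₂ : ℓ₂ ≠ p) (h₃ : ℓ₃ ≠ p)
    (hΔ₁ : ¬ (ℓ₁ : ℤ) ∣ discOf [a1, a2, a3, a4, a6]) (hΔ₂ : ¬ (ℓ₂ : ℤ) ∣ discOf [a1, a2, a3, a4, a6])
    (hΔ₃ : ¬ (ℓ₃ : ℤ) ∣ discOf [a1, a2, a3, a4, a6])
    {n₁ n₂ n₃ : ℕ} (hc₁ : countPoints [a1, a2, a3, a4, a6] ℓ₁ = n₁)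
    (hc₂ : countPoints [a1, a2, a3, a4, a6] ℓ₂ = n₂) (hc₃ : countPoints [a1, a2, a3, a4, a6] ℓ₃ = n₃)
    (r u : ZMod p)
    (hi : (((ℓ₁ : ℤ) + 1 - n₁ : ℤ) : ZMod p) ^ 2 - 4 * ℓ₁ = r * r ∧
      (((ℓ₁ : ℤ) + 1 - n₁ : ℤ) : ZMod p) ^ 2 - 4 * ℓ₁ ≠ 0 ∧ (((ℓ₁ : ℤ) + 1 - n₁ : ℤ) : ZMod p) ≠ 0)
    (hii : ((((ℓ₂ : ℤ) + 1 - n₂ : ℤ) : ZMod p) ^ 2 - 4 * ℓ₂) ^ (p / 2) = -1 ∧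
      (((ℓ₂ : ℤ) + 1 - n₂ : ℤ) : ZMod p) ≠ 0)
    (hiii : (((ℓ₃ : ℤ) + 1 - n₃ : ℤ) : ZMod p) ^ 2 = u * ℓ₃ ∧
      u ≠ 0 ∧ u ≠ 1 ∧ u ≠ 2 ∧ u ≠ 4 ∧ u ^ 2 - 3 * u + 1 ≠ 0) :
    Surj (⟨a1, a2, a3, a4, a6⟩ : WeierstrassCurve ℚ) p := by
  have h0 : discOf [a1, a2, a3, a4, a6] ≠ 0 := fun h ↦ hΔ₁ (by rw [h]; exact dvd_zero _)
  haveI := isElliptic_of_discOf_ne_zero a1 a2 a3 a4 a6 h0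
  haveI := hmin
  haveI : Fact ℓ₁.Prime := ⟨hℓ₁⟩
  haveI : Fact ℓ₂.Prime := ⟨hℓ₂⟩
  haveI : Fact ℓ₃.Prime := ⟨hℓ₃⟩
  have hp2 : p ≠ 2 := by omega
  have hI : integralModelInt (⟨a1, a2, a3, a4, a6⟩ : WeierstrassCurve ℚ) = ⟨a1, a2, a3, a4, a6⟩ :=
    integralModelInt_eq_of_map_eq _ (map_mk_int a1 a2 a3 a4 a6)
  refine hasSurjectiveModNGaloisRep_of_intModel_of_serreWitnesses hI p h5 ℓ₁ ℓ₂ ℓ₃ h₁ h₂ h₃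
    (by rw [intCurve_Δ]; exact hΔ₁) (by rw [intCurve_Δ]; exact hΔ₂) (by rw [intCurve_Δ]; exact hΔ₃)
    (natCard_point_eq_of_countPoints a1 a2 a3 a4 a6 ℓ₁ h2₁ hΔ₁ hc₁)
    (natCard_point_eq_of_countPoints a1 a2 a3 a4 a6 ℓ₂ h2₂ hΔ₂ hc₂)
    (natCard_point_eq_of_countPoints a1 a2 a3 a4 a6 ℓ₃ h2₃ hΔ₃ hc₃)
    ⟨⟨r, hi.1⟩, hi.2.1, hi.2.2⟩ ⟨(not_isSquare_of_pow_div_two_eq_neg_one p hp2 hii.1).1, hii.2⟩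
    ⟨u, hiii⟩

end Summit.BirchSwinnertonDyer.Rank1Residual.Supersingular

end
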